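import Literature.NumberTheory.Automorphic.ParallelWeightAdelicCoefficients
import Literature.NumberTheory.GaloisRepresentations.PadicAlgClFiniteSubextensionDvr
import Mathlib.Topology.Algebra.Module.FiniteDimension
import Mathlib.NumberTheory.Padics.RingHoms
import HarnessLib

/-!
# The coefficient ring `𝒪 ⊆ E₀ = ℚ_p(τ(F) : τ) ⊆ ℚ̄_p` of a number field's `p`-adic embeddings

Topic `NumberTheory/Automorphic`; namespace `Literature.NumberTheory.Automorphic`; definitions
with bodies and theorems.  The finite "field of coefficients" used to pass between the
`ℚ̄_p`-valued statement of `hidaControl_dominantOrdinaryPoint` and integral / torsion coefficients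
(Hida theory is done over the ring of integers `𝒪` of a finite extension `E/ℚ_p` containing all
embeddings of `F`; [KhareThorne2017, §6.1 (E ⊇ τ(F) for all τ)], [Hida1994AIF, §1]):

* `padicEmbField F p = E₀` — the subfield of `ℚ̄_p` generated over `ℚ_p` by the images of an
  integral basis of `F` under all embeddings `τ : F → ℚ̄_p`; finite-dimensional
  (`finiteDimensional_padicEmbField`), closed (`isClosed_padicEmbField`), complete, and containing
  every `τ(F)` (`apply_mem_padicEmbField`) and every `φ_τ(F_{v(τ)})`
  (`padicPlaceHom_mem_padicEmbField`, `φ_τ` the continuous extension `padicPlaceHom`);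
* `padicEmbInt F p = 𝒪` — its closed unit ball, a complete discrete valuation ring
  (`PadicAlgClFiniteSubextensionDvr`), with **`σ_τ = padicEmbIntHom τ : 𝒪_{F,v(τ)} → 𝒪`**
  (`‖φ_τ x‖ ≤ 1` for `v(x) ≤ 1`: `norm_padicPlaceHom_le_one`, by density of `𝓞 F` in `𝒪_v` and
  integrality of `τ(𝓞 F)`), `coe_padicEmbIntHom`;
* `ramIdxAt τ = e(v(τ) ∣ p)` with `v(p) = |ϖ_v|^e` (`valued_natCast_prime`), `one_le_ramIdxAt`;
* the reductions **`padicEmbRed τ N : 𝒪_{F,v(τ)} → 𝒪/p^N`** with the two hypotheses of the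
  independence-of-weight files: `padicEmbRed_eq_zero_of_valued_le` (it kills the closed ball of
  radius `|ϖ_v|^b` once `e N ≤ b`) and `padicEmbRed_pow_eq_zero` (`red(z)^r = 0` for `v(z) < 1`,
  `e N ≤ r`), and **`finite_padicEmbIntMod`: `𝒪/p^N` is finite** (`𝒪` is the integral closure of
  `ℤ_p` in `E₀`, a finitely generated `ℤ_p`-module, Mathlib `IsIntegralClosure.finite`).

## References

* C. Khare, J. A. Thorne, Amer. J. Math. 139 (2017), §6.1 (arXiv:1409.7007, held). [KhareThorne2017]
* J.-P. Serre, *Local Fields*, GTM 67, Ch. II §2, Prop. 3. [SerreLocalFields1979]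
* J. Neukirch, *Algebraic Number Theory* (1999), Ch. II §8 (pp. 160–161). [NeukirchANT1999]
-/

noncomputable section

open NumberField IsDedekindDomain Literature.NumberTheory.GaloisRepresentations

namespace Literature.NumberTheory.Automorphic

open ParallelWeight

variable (F : Type) [Field F] [NumberField F] (p : ℕ) [Fact p.Prime]

/-! ### The field `E₀ = ℚ_p(τ(F) : τ)` -/

/-- The generators `τ(bᵢ)`, `τ : F → ℚ̄_p`, `(bᵢ)` an integral basis of `F`. [folklore] -/
def padicEmbGenerators : Set (PadicAlgCl p) :=
  Set.range fun τi : (F →+* PadicAlgCl p) × Module.Free.ChooseBasisIndex ℤ (𝓞 F) =>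
    τi.1 (integralBasis F τi.2)

/-- There are finitely many generators. [folklore] -/
instance finite_padicEmbGenerators : Finite (padicEmbGenerators F p) :=
  (Set.finite_range _).to_subtype

omit [NumberField F] in
/-- `τ(a)` is integral over `ℤ` for `a ∈ 𝓞 F`. [folklore] -/
theorem isIntegral_int_apply (τ : F →+* PadicAlgCl p) (a : 𝓞 F) : IsIntegral ℤ (τ (a : F)) :=
  (RingOfIntegers.isIntegral_coe a).map τ.toIntAlgHom

/-- The generators are integral over `ℚ_p`. [folklore] -/
theorem isIntegral_of_mem_padicEmbGenerators {y : PadicAlgCl p} (hy : y ∈ padicEmbGenerators F p) :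
    IsIntegral ℚ_[p] y := by
  obtain ⟨⟨τ, i⟩, rfl⟩ := hy
  change IsIntegral ℚ_[p] (τ (integralBasis F i))
  rw [integralBasis_apply]
  exact (isIntegral_int_apply F p τ (RingOfIntegers.basis F i)).tower_top

/-- **`E₀ = ℚ_p(τ(F) : τ) ⊆ ℚ̄_p`.** [cite: KhareThorne2017, §6.1] -/
def padicEmbField : IntermediateField ℚ_[p] (PadicAlgCl p) :=
  IntermediateField.adjoin ℚ_[p] (padicEmbGenerators F p)

/-- `E₀` is finite over `ℚ_p`. [folklore] -/
instance finiteDimensional_padicEmbField : FiniteDimensional ℚ_[p] (padicEmbField F p) :=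
  IntermediateField.finiteDimensional_adjoin fun _ hy => isIntegral_of_mem_padicEmbGenerators F p hy

/-- **`τ(F) ⊆ E₀`** for every `τ : F → ℚ̄_p`. [folklore] -/
theorem apply_mem_padicEmbField (τ : F →+* PadicAlgCl p) (x : F) : τ x ∈ padicEmbField F p := by
  rw [← (integralBasis F).sum_repr x, map_sum]
  refine sum_mem fun i _ => ?_
  rw [Rat.smul_def, map_mul, map_ratCast, ← map_ratCast (algebraMap ℚ_[p] (PadicAlgCl p))]
  exact mul_mem (IntermediateField.algebraMap_mem _ _)
    (IntermediateField.subset_adjoin _ _ ⟨⟨τ, i⟩, rfl⟩)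

/-- `E₀` is closed in `ℚ̄_p` (finite-dimensional over the complete field `ℚ_p`). [folklore] -/
theorem isClosed_padicEmbField : IsClosed (padicEmbField F p : Set (PadicAlgCl p)) := by
  haveI : FiniteDimensional ℚ_[p] (padicEmbField F p).toSubalgebra.toSubmodule :=
    inferInstanceAs (FiniteDimensional ℚ_[p] (padicEmbField F p))
  exact (padicEmbField F p).toSubalgebra.toSubmodule.closed_of_finiteDimensional

/-- `E₀` is complete. [folklore] -/
instance completeSpace_padicEmbField : CompleteSpace (padicEmbField F p) :=
  PadicAlgCl.completeSpace _

/-- **`φ_τ(F_{v(τ)}) ⊆ E₀`**: `φ_τ` is continuous, `F` is dense in `F_{v(τ)}`, `τ(F) ⊆ E₀` and `E₀`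
is closed. [folklore] -/
theorem padicPlaceHom_mem_padicEmbField (τ : F →+* PadicAlgCl p)
    (x : (padicPlace F p τ).adicCompletion F) : padicPlaceHom F p τ x ∈ padicEmbField F p := by
  have hclosed : IsClosed ((padicPlaceHom F p τ) ⁻¹' (padicEmbField F p : Set (PadicAlgCl p))) :=
    (isClosed_padicEmbField F p).preimage (continuous_padicPlaceHom F p τ)
  have hsub : Set.range (algebraMap F ((padicPlace F p τ).adicCompletion F)) ⊆
      (padicPlaceHom F p τ) ⁻¹' (padicEmbField F p : Set (PadicAlgCl p)) := by
    rintro _ ⟨y, rfl⟩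
    change padicPlaceHom F p τ (algebraMap F _ y) ∈ (padicEmbField F p : Set (PadicAlgCl p))
    rw [padicPlaceHom_algebraMap]
    exact apply_mem_padicEmbField F p τ y
  have hx : x ∈ closure (Set.range (algebraMap F ((padicPlace F p τ).adicCompletion F))) := by
    rw [(HeightOneSpectrum.denseRange_algebraMap (K := F) (padicPlace F p τ)).closure_range]
    exact Set.mem_univ x
  exact hclosed.closure_subset_iff.2 hsub hx

/-- `φ_τ` as a ring homomorphism `F_{v(τ)} → E₀`. [folklore] -/
def padicPlaceHomE (τ : F →+* PadicAlgCl p) : (padicPlace F p τ).adicCompletion F →+* padicEmbField F p :=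
  (padicPlaceHom F p τ).codRestrict (padicEmbField F p) (padicPlaceHom_mem_padicEmbField F p τ)

/-- Unfolding `padicPlaceHomE`. [folklore] -/
@[simp]
theorem coe_padicPlaceHomE (τ : F →+* PadicAlgCl p) (x : (padicPlace F p τ).adicCompletion F) :
    (padicPlaceHomE F p τ x : PadicAlgCl p) = padicPlaceHom F p τ x :=
  rfl

/-! ### `‖φ_τ‖ ≤ 1` on `𝒪_{v(τ)}` -/

omit [NumberField F] in
/-- `‖τ a‖ ≤ 1` for `a ∈ 𝓞 F` (integral over `ℤ`, hence over `ℤ_p`). [folklore] -/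
theorem norm_apply_ringOfIntegers_le_one (τ : F →+* PadicAlgCl p) (a : 𝓞 F) : ‖τ (a : F)‖ ≤ 1 :=
  (PadicAlgCl.norm_le_one_iff_isIntegral _).2 (isIntegral_int_apply F p τ a).tower_top

/-- **`‖τ k‖ ≤ 1` for a `v(τ)`-integer `k ∈ F`**: write `k d = n` with `n, d ∈ 𝓞 F`, `d ∉ v(τ)`
(Mathlib `exists_primeCompl_mul_eq_of_integer`); `‖τ n‖ ≤ 1` and `‖τ d‖ = 1`
(`valued_lt_one_iff_mem_padicPlace`). [folklore] -/
theorem norm_apply_le_one_of_valuation_le_one (τ : F →+* PadicAlgCl p) (k : F)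
    (hk : (padicPlace F p τ).valuation F k ≤ 1) : ‖τ k‖ ≤ 1 := by
  obtain ⟨n, d, hnd⟩ := HeightOneSpectrum.exists_primeCompl_mul_eq_of_integer (padicPlace F p τ) k hk
  have hd1 : ‖τ ((d : 𝓞 F) : F)‖ = 1 := by
    refine le_antisymm (norm_apply_ringOfIntegers_le_one F p τ d) (not_lt.1 fun hlt => d.2 ?_)
    refine (valued_lt_one_iff_mem_padicPlace F p τ (d : 𝓞 F)).1 ?_
    rw [PadicAlgCl.valuation_def, ← NNReal.coe_lt_coe, coe_nnnorm, NNReal.coe_one]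
    exact hlt
  have h := congrArg (fun z => ‖τ z‖) hnd
  simp only [map_mul, norm_mul] at h
  change ‖τ k‖ * ‖τ ((d : 𝓞 F) : F)‖ = ‖τ ((n : 𝓞 F) : F)‖ at h
  rw [hd1, mul_one] at h
  rw [h]
  exact norm_apply_ringOfIntegers_le_one F p τ n

/-- **`‖φ_τ x‖ ≤ 1` for `v(x) ≤ 1`**: `F ∩ 𝒪_v` is dense in the open set `𝒪_v`
(Mathlib `denseRange_algebraMap`) and `{‖φ_τ‖ ≤ 1}` is closed. [folklore] -/
theorem norm_padicPlaceHom_le_one (τ : F →+* PadicAlgCl p) {x : (padicPlace F p τ).adicCompletion F}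
    (hx : Valued.v x ≤ 1) : ‖padicPlaceHom F p τ x‖ ≤ 1 := by
  have hC : IsClosed {y : (padicPlace F p τ).adicCompletion F | ‖padicPlaceHom F p τ y‖ ≤ 1} :=
    isClosed_le (continuous_norm.comp (continuous_padicPlaceHom F p τ)) continuous_const
  have hO : IsOpen (((padicPlace F p τ).adicCompletionIntegers F : Set ((padicPlace F p τ).adicCompletion F))) :=
    Valued.isOpen_valuationSubring _
  have hxO : x ∈ (((padicPlace F p τ).adicCompletionIntegers F : Set ((padicPlace F p τ).adicCompletion F))) := hx
  have hcl := (HeightOneSpectrum.denseRange_algebraMap (K := F) (padicPlace F p τ)).subset_closure_image_preimage_of_isOpen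
    hO hxO
  refine hC.closure_subset_iff.2 ?_ hcl
  rintro _ ⟨k, hk, rfl⟩
  have hk1 : (padicPlace F p τ).valuation F k ≤ 1 := by
    rw [← HeightOneSpectrum.valuedAdicCompletion_eq_valuation']
    exact hk
  change ‖padicPlaceHom F p τ (algebraMap F _ k)‖ ≤ 1
  rw [padicPlaceHom_algebraMap]
  exact norm_apply_le_one_of_valuation_le_one F p τ k hk1

/-! ### The ring `𝒪 = {‖·‖ ≤ 1} ⊆ E₀` and `σ_τ : 𝒪_{F,v(τ)} → 𝒪` -/

/-- **`𝒪 ⊆ E₀`, the closed unit ball** (valuation subring of the restricted `p`-adic valuation).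
[cite: KhareThorne2017, §6.1] -/
abbrev padicEmbInt : ValuationSubring (padicEmbField F p) :=
  (Valued.v.comap (algebraMap (padicEmbField F p) (PadicAlgCl p))).valuationSubring

/-- `𝒪` is a discrete valuation ring (`PadicAlgClFiniteSubextensionDvr`).
[cite: SerreLocalFields1979, Ch. II §2, Prop. 3] -/
instance isDiscreteValuationRing_padicEmbInt : IsDiscreteValuationRing (padicEmbInt F p) :=
  PadicAlgCl.isDiscreteValuationRing_unitBall _

/-- **`σ_τ : 𝒪_{F,v(τ)} → 𝒪`**, the restriction of `φ_τ` to integers. [cite: KhareThorne2017, §6.1] -/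
def padicEmbIntHom (τ : F →+* PadicAlgCl p) :
    (padicPlace F p τ).adicCompletionIntegers F →+* padicEmbInt F p :=
  ((padicPlaceHomE F p τ).comp ((padicPlace F p τ).adicCompletionIntegers F).subtype).codRestrict
    (padicEmbInt F p) fun x => (PadicAlgCl.mem_unitBall_iff _ _).2 (norm_padicPlaceHom_le_one F p τ x.2)

/-- Unfolding `padicEmbIntHom`: `σ_τ x = φ_τ x` in `ℚ̄_p`. [folklore] -/
@[simp]
theorem coe_padicEmbIntHom (τ : F →+* PadicAlgCl p) (x : (padicPlace F p τ).adicCompletionIntegers F) :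
    (((padicEmbIntHom F p τ x : padicEmbInt F p) : padicEmbField F p) : PadicAlgCl p) =
      padicPlaceHom F p τ (x : (padicPlace F p τ).adicCompletion F) :=
  rfl

/-! ### The ramification index of `v(τ)` and divisibility by `p^N` -/

/-- **`e(v(τ) ∣ p)`**, the multiplicity of `v(τ)` in `(p)`. [folklore] -/
def ramIdxAt (τ : F →+* PadicAlgCl p) : ℕ :=
  multiplicity (padicPlace F p τ).asIdeal (Ideal.span {((p : ℕ) : 𝓞 F)})

/-- **`v(p) = |ϖ_v|^e`** in `F_{v(τ)}`. [folklore] -/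
theorem valued_natCast_prime (τ : F →+* PadicAlgCl p) :
    Valued.v ((p : ℕ) : (padicPlace F p τ).adicCompletion F) =
      WithZero.exp (-(ramIdxAt F p τ : ℤ)) := by
  have hp : ((p : ℕ) : 𝓞 F) ≠ 0 := by exact_mod_cast (Fact.out : p.Prime).ne_zero
  have hcast : ((p : ℕ) : (padicPlace F p τ).adicCompletion F) =
      algebraMap F ((padicPlace F p τ).adicCompletion F) (algebraMap (𝓞 F) F ((p : ℕ) : 𝓞 F)) := by
    rw [map_natCast, map_natCast]
  have hval : ∀ c : F, Valued.v (algebraMap F ((padicPlace F p τ).adicCompletion F) c) =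
      (padicPlace F p τ).valuation F c :=
    fun c => HeightOneSpectrum.valuedAdicCompletion_eq_valuation' _ c
  rw [hcast, hval, HeightOneSpectrum.valuation_of_algebraMap,
    (padicPlace F p τ).intValuation_eq_exp_neg_multiplicity hp]
  rfl

/-- `1 ≤ e` (`p ∈ v(τ)`). [folklore] -/
theorem one_le_ramIdxAt (τ : F →+* PadicAlgCl p) : 1 ≤ ramIdxAt F p τ := by
  have hp : ((p : ℕ) : 𝓞 F) ≠ 0 := by exact_mod_cast (Fact.out : p.Prime).ne_zero
  have h := ((padicPlace F p τ).intValuation_lt_one_iff_mem _).2 (natCast_mem_padicPlace F p τ)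
  rw [(padicPlace F p τ).intValuation_eq_exp_neg_multiplicity hp, ← WithZero.exp_zero,
    WithZero.exp_lt_exp] at h
  unfold ramIdxAt
  omega

/-- `p ≠ 0` in `F_{v(τ)}`. [folklore] -/
theorem natCast_prime_ne_zero (τ : F →+* PadicAlgCl p) :
    ((p : ℕ) : (padicPlace F p τ).adicCompletion F) ≠ 0 := by
  rw [← (Valued.v).ne_zero_iff, valued_natCast_prime]
  exact WithZero.coe_ne_zero

/-- **Divisibility by `p^N` in `𝒪_{v(τ)}`**: `v(x) ≤ v(p^N)` gives `x = p^N y` with `v(y) ≤ 1`.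
[folklore] -/
theorem exists_eq_prime_pow_mul (τ : F →+* PadicAlgCl p) (N : ℕ) {x : (padicPlace F p τ).adicCompletion F}
    (hx : Valued.v x ≤ Valued.v (((p : ℕ) : (padicPlace F p τ).adicCompletion F) ^ N)) :
    ∃ y : (padicPlace F p τ).adicCompletion F, Valued.v y ≤ 1 ∧
      x = ((p : ℕ) : (padicPlace F p τ).adicCompletion F) ^ N * y := by
  have hpN : (((p : ℕ) : (padicPlace F p τ).adicCompletion F) ^ N) ≠ 0 :=
    pow_ne_zero N (natCast_prime_ne_zero F p τ)
  refine ⟨x / ((p : ℕ) : (padicPlace F p τ).adicCompletion F) ^ N, ?_, ?_⟩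
  · rw [map_div₀, div_le_one₀ ((Valued.v).pos_iff.2 hpN)]
    exact hx
  · rw [mul_div_cancel₀ _ hpN]

/-- `|ϖ_v|^b ≤ v(p^N)` once `e N ≤ b`. [folklore] -/
theorem exp_neg_le_valued_prime_pow (τ : F →+* PadicAlgCl p) {N b : ℕ} (hb : ramIdxAt F p τ * N ≤ b) :
    (WithZero.exp (-(b : ℤ)) : WithZero (Multiplicative ℤ)) ≤
      Valued.v (((p : ℕ) : (padicPlace F p τ).adicCompletion F) ^ N) := by
  rw [map_pow, valued_natCast_prime, ← WithZero.exp_nsmul, WithZero.exp_le_exp]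
  have h : (N : ℤ) * (ramIdxAt F p τ : ℤ) ≤ (b : ℤ) := by exact_mod_cast (Nat.mul_comm N _).le.trans hb
  simpa only [smul_neg, nsmul_eq_mul, neg_le_neg_iff] using h

/-! ### The reductions `𝒪_{F,v(τ)} → 𝒪/p^N` -/

/-- **`𝒪/p^N`.** [folklore] -/
abbrev padicEmbIntMod (N : ℕ) : Type :=
  padicEmbInt F p ⧸ Ideal.span {((p : ℕ) : padicEmbInt F p) ^ N}

/-- **`red_τ = (𝒪 → 𝒪/p^N) ∘ σ_τ : 𝒪_{F,v(τ)} → 𝒪/p^N`.** [cite: KhareThorne2017, §6.4] -/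
def padicEmbRed (τ : F →+* PadicAlgCl p) (N : ℕ) :
    (padicPlace F p τ).adicCompletionIntegers F →+* padicEmbIntMod F p N :=
  (Ideal.Quotient.mk _).comp (padicEmbIntHom F p τ)

/-- **`red_τ` kills the closed ball of radius `|ϖ_v|^b`** as soon as `e N ≤ b` (the radius-`b`
hypothesis `hred` of `HidaIndependenceOfWeightTower`/`…Tensor`). [folklore] -/
theorem padicEmbRed_eq_zero_of_valued_le (τ : F →+* PadicAlgCl p) {N b : ℕ} (hb : ramIdxAt F p τ * N ≤ b)
    (x : (padicPlace F p τ).adicCompletionIntegers F)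
    (hx : Valued.v (x : (padicPlace F p τ).adicCompletion F) ≤
      (WithZero.exp (-(b : ℤ)) : WithZero (Multiplicative ℤ))) :
    padicEmbRed F p τ N x = 0 := by
  obtain ⟨y, hy1, hxy⟩ := exists_eq_prime_pow_mul F p τ N (hx.trans (exp_neg_le_valued_prime_pow F p τ hb))
  have hx' : x = ((p : ℕ) : (padicPlace F p τ).adicCompletionIntegers F) ^ N * ⟨y, hy1⟩ :=
    Subtype.ext (by push_cast; exact hxy)
  rw [padicEmbRed, RingHom.comp_apply, Ideal.Quotient.eq_zero_iff_mem, hx', map_mul, map_pow, map_natCast]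
  exact Ideal.mul_mem_right _ _ (Ideal.mem_span_singleton_self _)

/-- **`red_τ(z)^r = 0` for `v(z) < 1` and `e N ≤ r`** (e.g. `z = ϖ_v`: the hypothesis `hr` of the
independence-of-weight files). [folklore] -/
theorem padicEmbRed_pow_eq_zero (τ : F →+* PadicAlgCl p) {N r : ℕ} (hr : ramIdxAt F p τ * N ≤ r)
    (z : (padicPlace F p τ).adicCompletionIntegers F)
    (hz : Valued.v (z : (padicPlace F p τ).adicCompletion F) ≤
      (WithZero.exp (-1 : ℤ) : WithZero (Multiplicative ℤ))) :
    padicEmbRed F p τ N z ^ r = 0 := by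
  rw [← map_pow]
  refine padicEmbRed_eq_zero_of_valued_le F p τ hr _ ?_
  push_cast
  rw [map_pow, show (-(r : ℤ)) = r • (-1 : ℤ) by simp, WithZero.exp_nsmul]
  exact pow_le_pow_left' hz r

/-! ### `𝒪/p^N` is finite -/

/-- `𝒪` is the integral closure of `ℤ_p` in `E₀`, as rings. [folklore] -/
def padicEmbIntEquivIntegralClosure : integralClosure ℤ_[p] (padicEmbField F p) ≃+* padicEmbInt F p :=
  RingEquiv.subringCongr (PadicAlgCl.unitBall_toSubring_eq_integralClosure _).symm

/-- A finitely generated `ℤ_p`-module killed by `p^N` is finite. [folklore] -/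
theorem finite_of_moduleFinite_of_prime_pow_smul_eq_zero (N : ℕ) (M : Type) [AddCommGroup M]
    [Module ℤ_[p] M] [Module.Finite ℤ_[p] M] (hM : ∀ m : M, ((p : ℤ_[p]) ^ N) • m = 0) : Finite M := by
  set 𝔞 : Ideal ℤ_[p] := Ideal.span {((p : ℤ_[p])) ^ N} with h𝔞
  have hT : Module.IsTorsionBySet ℤ_[p] M 𝔞 := by
    rintro m ⟨a, ha⟩
    obtain ⟨c, rfl⟩ := Ideal.mem_span_singleton'.1 ha
    change (c * (p : ℤ_[p]) ^ N) • m = 0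
    rw [mul_smul, hM, smul_zero]
  letI : Module (ℤ_[p] ⧸ 𝔞) M := hT.module
  haveI : IsScalarTower ℤ_[p] (ℤ_[p] ⧸ 𝔞) M := hT.isScalarTower
  haveI : Module.Finite (ℤ_[p] ⧸ 𝔞) M := Module.Finite.of_restrictScalars_finite ℤ_[p] _ _
  haveI : Finite (ℤ_[p] ⧸ 𝔞) := by
    have e : ℤ_[p] ⧸ RingHom.ker (PadicInt.toZModPow N) ≃+* ZMod (p ^ N) :=
      RingHom.quotientKerEquivOfSurjective (ZMod.ringHom_surjective (PadicInt.toZModPow N))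
    rw [h𝔞, ← PadicInt.ker_toZModPow]
    exact Finite.of_equiv _ e.toEquiv.symm
  exact Module.finite_of_finite (ℤ_[p] ⧸ 𝔞)

/-- **`𝒪/p^N` is finite.** [cite: SerreLocalFields1979, Ch. II §2, Prop. 3] -/
instance finite_padicEmbIntMod (N : ℕ) : Finite (padicEmbIntMod F p N) := by
  haveI : IsScalarTower ℤ_[p] (padicEmbField F p) (PadicAlgCl p) := IsScalarTower.of_algebraMap_eq fun x => by
    rw [IsScalarTower.algebraMap_apply ℤ_[p] ℚ_[p] (PadicAlgCl p),
      IsScalarTower.algebraMap_apply ℤ_[p] ℚ_[p] (padicEmbField F p),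
      ← IsScalarTower.algebraMap_apply ℚ_[p] (padicEmbField F p)]
  set C := integralClosure ℤ_[p] (padicEmbField F p) with hC
  haveI : Module.Finite ℤ_[p] C := IsIntegralClosure.finite ℤ_[p] ℚ_[p] (padicEmbField F p) C
  set I : Ideal C := Ideal.span {((p : ℕ) : C) ^ N} with hI
  -- `C ⧸ p^N` is finite
  haveI : Module.Finite ℤ_[p] (C ⧸ I) :=
    Module.Finite.of_surjective (Ideal.Quotient.mkₐ ℤ_[p] I).toLinearMap (Ideal.Quotient.mkₐ_surjective ℤ_[p] I)
  have hfin : Finite (C ⧸ I) := by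
    refine finite_of_moduleFinite_of_prime_pow_smul_eq_zero p N (C ⧸ I) fun m => ?_
    obtain ⟨c, rfl⟩ := Ideal.Quotient.mk_surjective m
    have hc : ((p : ℤ_[p]) ^ N) • c = ((p : ℕ) : C) ^ N * c := by
      rw [Algebra.smul_def, map_pow, map_natCast]
    rw [← Ideal.Quotient.mkₐ_eq_mk ℤ_[p], ← map_smul, hc, Ideal.Quotient.mkₐ_eq_mk,
      Ideal.Quotient.eq_zero_iff_mem]
    exact Ideal.mul_mem_right _ _ (Ideal.mem_span_singleton_self _)
  -- transport along `C ≃ 𝒪`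
  have hIJ : Ideal.span {((p : ℕ) : padicEmbInt F p) ^ N} =
      Ideal.map (padicEmbIntEquivIntegralClosure F p : C →+* padicEmbInt F p) I := by
    rw [hI, Ideal.map_span, Set.image_singleton, map_pow, map_natCast]
  exact Finite.of_equiv _ (Ideal.quotientEquiv I _ (padicEmbIntEquivIntegralClosure F p) hIJ).toEquiv

end Literature.NumberTheory.Automorphic
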